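import Mathlib.RingTheory.Kaehler.Basic
import Mathlib.LinearAlgebra.ExteriorPower.Basic
import Mathlib.LinearAlgebra.Multilinear.Curry
import Mathlib.LinearAlgebra.Quotient.Basic
import Mathlib.LinearAlgebra.Finsupp.LinearCombination
import Literature.NumberTheory.GaloisCohomology.KatoCohomologyDifferentialForms
import HarnessLib

/-!
# The Bloch–Kato presentation module of `Ωⁿ_K` (Bloch–Kato 1986, Lemma (4.2)): the module and
# the comparison map `Ωⁿ_K → (K ⊗ (Kˣ)^{⊗ n})/J`

For a field `K`, Bloch–Kato's Lemma (4.2) [cite: BlochKato1986, Lemma (4.2), p. 122] presents the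
absolute differential `n`-forms `Ωⁿ_K = ⋀ⁿ_K Ω[K⁄ℤ]` as `(K ⊗ (Kˣ)^{⊗ n})/J`, generators
`x ⊗ y₁ ⊗ ⋯ ⊗ yₙ ↦ x · dy₁/y₁ ∧ ⋯ ∧ dyₙ/yₙ`, `J` generated by (4.2.1) (`yᵢ = yⱼ` for some `i ≠ j`)
and (4.2.2) (`Σ xᵢ ⊗ xᵢ ⊗ y − Σ xᵢ' ⊗ xᵢ' ⊗ y` for `Σ xᵢ = Σ xᵢ'`).  This file builds that
presentation module as a `K`-module `BlochKatoForms K n` (free on the tuples `Fin n → K`, modulo the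
`K`-span of: multiplicativity in each slot, vanishing when a slot is `0`, vanishing when two slots
agree, and (4.2.2) slotwise — `(x + x') • e(…, x + x', …) = x • e(…, x, …) + x' • e(…, x', …)`), and
the HARD direction of the lemma, the `K`-linear map

`BlochKatoForms.ofForms K n : ⋀[K]^n (Ω[K⁄ℤ]) →ₗ[K] BlochKatoForms K n`,
`b • (da₁ ∧ ⋯ ∧ daₙ) ↦ (b · ∏ aᵢ) • e(a₁, …, aₙ)` (`ofForms_ιMulti_D`),
`dlog b₁ ∧ ⋯ ∧ dlog bₙ ↦ e(b₁, …, bₙ)` (`ofForms_dlogForm`),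

constructed slot by slot from the derivation `a ↦ a • e(a, –)` (`Derivation.liftKaehlerDifferential`,
`LinearMap.uncurryLeft`) and the universal property of the exterior power
(`exteriorPower.alternatingMapLinearEquiv`); the alternating property is proved from the relations
by a polarisation argument on the spanning set `{da}` of `Ω[K⁄ℤ]`.  Consumer: the proof of the named
fact `BlochKato1986_symbolicPresentation` (file `KatoCohomologyDifferentialForms`), via
`BlochKatoFormsSymbol` (the additive map `BlochKatoForms K n → KatoCohomologySymbolic p K n`).
Everything here is proved; no named fact is introduced.

## References

* S. Bloch, K. Kato, *p-adic étale cohomology*, Publ. Math. IHÉS 63 (1986), 107–152, Lemma (4.2),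
  p. 122 ("Straightforward and left to the reader"). [BlochKato1986]
* K. Kato, *Galois cohomology of complete discrete valuation fields*, LNM 967 (1982), §1 (the
  symbols `x · dy₁/y₁ ∧ ⋯`). [Kato1982]
-/

noncomputable section

open KaehlerDifferential (D)
open Function (update)

namespace Literature.NumberTheory.GaloisCohomology

universe u v

variable (K : Type u) [Field K] (n : ℕ)

namespace BlochKatoForms

/-- The defining relations of the Bloch–Kato presentation module of `Ωⁿ_K`, inside the free
`K`-module on the tuples `v : Fin n → K` (the generator `e v = single v 1` stands for
`dlog (v 0) ∧ ⋯ ∧ dlog (v (n-1))`): (Z) `e v = 0` if some `v i = 0`; (M) multiplicativity in each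
slot, `e(…, c c', …) = e(…, c, …) + e(…, c', …)` (`c, c' ≠ 0`); (A) `e v = 0` if `v i = v j` for some
`i ≠ j` ((4.2.1)); (Q) `(c + c') • e(…, c + c', …) = c • e(…, c, …) + c' • e(…, c', …)` ((4.2.2)).
[cite: BlochKato1986, Lemma (4.2), p. 122] -/
def rels : Set ((Fin n → K) →₀ K) :=
  {x | (∃ (v : Fin n → K) (i : Fin n), v i = 0 ∧ x = Finsupp.single v 1) ∨
    (∃ (v : Fin n → K) (i : Fin n) (c c' : K), c ≠ 0 ∧ c' ≠ 0 ∧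
      x = Finsupp.single (update v i (c * c')) 1 - Finsupp.single (update v i c) 1 -
        Finsupp.single (update v i c') 1) ∨
    (∃ (v : Fin n → K) (i j : Fin n), i ≠ j ∧ v i = v j ∧ x = Finsupp.single v 1) ∨
    (∃ (v : Fin n → K) (i : Fin n) (c c' : K),
      x = (c + c') • Finsupp.single (update v i (c + c')) 1 - c • Finsupp.single (update v i c) 1 -
        c' • Finsupp.single (update v i c') 1)}

end BlochKatoForms

/-- **The Bloch–Kato presentation module of `Ωⁿ_K`**: the free `K`-module on the tuples
`Fin n → K` modulo the `K`-span of the relations `BlochKatoForms.rels` (multiplicativity in each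
slot, vanishing on a zero slot or on two equal slots, and Bloch–Kato's (4.2.2)).  It receives the
comparison map `BlochKatoForms.ofForms : ⋀ⁿ_K Ω[K⁄ℤ] → BlochKatoForms K n`, `dlog b₁ ∧ ⋯ ∧ dlog bₙ ↦
e(b₁, …, bₙ)`. [cite: BlochKato1986, Lemma (4.2), p. 122] -/
abbrev BlochKatoForms : Type u :=
  ((Fin n → K) →₀ K) ⧸ Submodule.span K (BlochKatoForms.rels K n)

namespace BlochKatoForms

variable {n}

/-- The generator `e v ∈ BlochKatoForms K n` of the tuple `v` (standing for
`dlog (v 0) ∧ ⋯ ∧ dlog (v (n-1))`). [cite: BlochKato1986, Lemma (4.2)] -/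
def gen (v : Fin n → K) : BlochKatoForms K n :=
  Submodule.Quotient.mk (Finsupp.single v 1)

/-- `mk (single v c) = c • e v`. [folklore] -/
theorem mk_single (v : Fin n → K) (c : K) :
    (Submodule.Quotient.mk (Finsupp.single v c) : BlochKatoForms K n) = c • gen K v := by
  rw [gen, ← Submodule.Quotient.mk_smul, Finsupp.smul_single_one]

variable {K}

/-- A defining relation vanishes in the quotient. [folklore] -/
theorem mk_eq_zero_of_mem_rels {x : (Fin n → K) →₀ K} (hx : x ∈ rels K n) :
    (Submodule.Quotient.mk x : BlochKatoForms K n) = 0 :=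
  (Submodule.Quotient.mk_eq_zero _).2 (Submodule.subset_span hx)

variable (K)

/-- Relation (Z): `e v = 0` if some slot of `v` vanishes. [cite: BlochKato1986, Lemma (4.2)] -/
theorem gen_eq_zero_of_apply_eq_zero (v : Fin n → K) (i : Fin n) (h : v i = 0) : gen K v = 0 :=
  mk_eq_zero_of_mem_rels (Or.inl ⟨v, i, h, rfl⟩)

/-- Relation (M): multiplicativity in the slot `i`,
`e(…, c c', …) = e(…, c, …) + e(…, c', …)` for `c, c' ≠ 0`. [cite: BlochKato1986, Lemma (4.2)] -/
theorem gen_update_mul (v : Fin n → K) (i : Fin n) {c c' : K} (hc : c ≠ 0) (hc' : c' ≠ 0) :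
    gen K (update v i (c * c')) = gen K (update v i c) + gen K (update v i c') := by
  have h := mk_eq_zero_of_mem_rels (K := K) (Or.inr <| Or.inl ⟨v, i, c, c', hc, hc', rfl⟩)
  rw [Submodule.Quotient.mk_sub, Submodule.Quotient.mk_sub, sub_sub, sub_eq_zero] at h
  exact h

/-- Relation (A), (4.2.1): `e v = 0` if two distinct slots of `v` agree.
[cite: BlochKato1986, Lemma (4.2), (4.2.1)] -/
theorem gen_eq_zero_of_apply_eq (v : Fin n → K) {i j : Fin n} (hij : i ≠ j) (h : v i = v j) :
    gen K v = 0 :=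
  mk_eq_zero_of_mem_rels (Or.inr <| Or.inr <| Or.inl ⟨v, i, j, hij, h, rfl⟩)

/-- Relation (Q), (4.2.2): `(c + c') • e(…, c + c', …) = c • e(…, c, …) + c' • e(…, c', …)`.
[cite: BlochKato1986, Lemma (4.2), (4.2.2)] -/
theorem add_smul_gen_update (v : Fin n → K) (i : Fin n) (c c' : K) :
    (c + c') • gen K (update v i (c + c')) = c • gen K (update v i c) + c' • gen K (update v i c') := by
  have h := mk_eq_zero_of_mem_rels (K := K) (Or.inr <| Or.inr <| Or.inr ⟨v, i, c, c', rfl⟩)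
  rw [Submodule.Quotient.mk_sub, Submodule.Quotient.mk_sub, sub_sub, sub_eq_zero,
    Submodule.Quotient.mk_smul, Submodule.Quotient.mk_smul, Submodule.Quotient.mk_smul] at h
  exact h

/-- `e(…, 1, …) = 0` (from (M) with `c = c' = 1`). [folklore] -/
theorem gen_update_one (v : Fin n → K) (i : Fin n) : gen K (update v i 1) = 0 := by
  have h := gen_update_mul K v i one_ne_zero one_ne_zero
  rw [mul_one] at h
  -- `h : g = g + g`
  have h' : gen K (update v i 1) + gen K (update v i 1) = gen K (update v i 1) + 0 := by
    rw [add_zero]; exact h.symm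
  exact add_left_cancel h'

/-- Two `K`-linear maps out of `BlochKatoForms K n` agreeing on the generators `e v` are equal.
[folklore] -/
theorem hom_ext {N : Type v} [AddCommGroup N] [Module K N] {f g : BlochKatoForms K n →ₗ[K] N}
    (h : ∀ v, f (gen K v) = g (gen K v)) : f = g :=
  Submodule.linearMap_qext _ (Finsupp.lhom_ext fun v c => by
    change f (Submodule.Quotient.mk (Finsupp.single v c)) = g (Submodule.Quotient.mk (Finsupp.single v c))
    rw [mk_single, map_smul, map_smul, h])

variable {K}

/-- UNIVERSAL PROPERTY: a map on tuples respecting the relations (Z), (M), (A), (Q) extends to a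
`K`-linear map out of `BlochKatoForms K n`. [folklore] -/
def lift {N : Type v} [AddCommGroup N] [Module K N] (f : (Fin n → K) → N)
    (hZ : ∀ (v : Fin n → K) (i : Fin n), v i = 0 → f v = 0)
    (hM : ∀ (v : Fin n → K) (i : Fin n) (c c' : K), c ≠ 0 → c' ≠ 0 →
      f (update v i (c * c')) = f (update v i c) + f (update v i c'))
    (hA : ∀ (v : Fin n → K) (i j : Fin n), i ≠ j → v i = v j → f v = 0)
    (hQ : ∀ (v : Fin n → K) (i : Fin n) (c c' : K),
      (c + c') • f (update v i (c + c')) = c • f (update v i c) + c' • f (update v i c')) :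
    BlochKatoForms K n →ₗ[K] N :=
  (Submodule.span K (rels K n)).liftQ (Finsupp.linearCombination K f) (Submodule.span_le.2 (by
    rintro x (⟨v, i, hv, rfl⟩ | ⟨v, i, c, c', hc, hc', rfl⟩ | ⟨v, i, j, hij, hv, rfl⟩ |
      ⟨v, i, c, c', rfl⟩)
    · simp only [SetLike.mem_coe, LinearMap.mem_ker, Finsupp.linearCombination_single, one_smul,
        hZ v i hv]
    · simp only [SetLike.mem_coe, LinearMap.mem_ker, map_sub, Finsupp.linearCombination_single,
        one_smul, hM v i c c' hc hc']
      abel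
    · simp only [SetLike.mem_coe, LinearMap.mem_ker, Finsupp.linearCombination_single, one_smul,
        hA v i j hij hv]
    · simp only [SetLike.mem_coe, LinearMap.mem_ker, map_sub, map_smul,
        Finsupp.linearCombination_single, one_smul, hQ v i c c']
      abel))

/-- The lift takes the prescribed values on generators. [folklore] -/
@[simp] theorem lift_gen {N : Type v} [AddCommGroup N] [Module K N] (f : (Fin n → K) → N) (hZ hM hA hQ)
    (v : Fin n → K) : lift f hZ hM hA hQ (gen K v) = f v := by
  simp only [lift, gen, Submodule.liftQ_apply, Finsupp.linearCombination_single, one_smul]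

variable (K n)

/-- `update (cons a (cons x v)) 1 y = cons a (cons y v)`. [folklore] -/
private theorem update_cons_cons_one {α : Type*} (a x y : α) (v : Fin n → α) :
    update (Fin.cons a (Fin.cons x v) : Fin (n + 2) → α) 1 y = Fin.cons a (Fin.cons y v) := by
  rw [show (1 : Fin (n + 2)) = (0 : Fin (n + 1)).succ from rfl, ← Fin.cons_update,
    Fin.update_cons_zero]

/-- **Prepending a slot**: the `K`-linear map `e v ↦ e(a, v)` from `BlochKatoForms K n` to
`BlochKatoForms K (n + 1)` (well defined: the relations in the slots of `v` are relations in the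
shifted slots of `Fin.cons a v`). [folklore] -/
def consMap (a : K) : BlochKatoForms K n →ₗ[K] BlochKatoForms K (n + 1) :=
  lift (fun v => gen K (Fin.cons a v))
    (fun v i hv => gen_eq_zero_of_apply_eq_zero K _ i.succ (by simpa using hv))
    (fun v i c c' hc hc' => by simpa only [Fin.cons_update] using gen_update_mul K _ i.succ hc hc')
    (fun v i j hij hv => gen_eq_zero_of_apply_eq K _ (Fin.succ_injective _ |>.ne hij) (by simpa using hv))
    (fun v i c c' => by simpa only [Fin.cons_update] using add_smul_gen_update K _ i.succ c c')

/-- `consMap a (e v) = e(a, v)`. [folklore] -/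
@[simp] theorem consMap_gen (a : K) (v : Fin n → K) : consMap K n a (gen K v) = gen K (Fin.cons a v) :=
  lift_gen _ _ _ _ _ v

/-- `consMap (a b) = consMap a + consMap b` for `a, b ≠ 0` (relation (M) in the new slot).
[folklore] -/
theorem consMap_mul {a b : K} (ha : a ≠ 0) (hb : b ≠ 0) :
    consMap K n (a * b) = consMap K n a + consMap K n b :=
  hom_ext K fun v => by
    simpa only [consMap_gen, LinearMap.add_apply, Fin.update_cons_zero] using
      gen_update_mul K (Fin.cons a v) 0 ha hb

/-- `(a + b) • consMap (a + b) = a • consMap a + b • consMap b` (relation (Q) in the new slot).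
[folklore] -/
theorem add_smul_consMap (a b : K) :
    (a + b) • consMap K n (a + b) = a • consMap K n a + b • consMap K n b :=
  hom_ext K fun v => by
    simpa only [consMap_gen, LinearMap.add_apply, LinearMap.smul_apply, Fin.update_cons_zero] using
      add_smul_gen_update K (Fin.cons a v) 0 a b

/-- `consMap 1 = 0`. [folklore] -/
theorem consMap_one : consMap K n 1 = 0 :=
  hom_ext K fun v => by
    simpa only [consMap_gen, LinearMap.zero_apply, Fin.update_cons_zero] using
      gen_update_one K (Fin.cons (1 : K) v) 0

/-- `e(a, a, v) = 0` (relation (A) in the two new slots): `consMap a ∘ consMap a = 0`. [folklore] -/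
theorem consMap_comp_consMap_self (a : K) :
    (consMap K (n + 1) a).comp (consMap K n a) = 0 :=
  hom_ext K fun v => by
    simp only [LinearMap.comp_apply, consMap_gen, LinearMap.zero_apply]
    exact gen_eq_zero_of_apply_eq K _ (i := 0) (j := 1) zero_ne_one (by simp)

/-- Antisymmetry in the two new slots, `e(a, b, v) + e(b, a, v) = 0` (`a, b ≠ 0`), derived from (M)
and (A) by expanding `e(ab, ab, v) = 0`: `consMap a ∘ consMap b + consMap b ∘ consMap a = 0`.
[folklore] -/
theorem consMap_comp_consMap_add {a b : K} (ha : a ≠ 0) (hb : b ≠ 0) :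
    (consMap K (n + 1) a).comp (consMap K n b) + (consMap K (n + 1) b).comp (consMap K n a) = 0 := by
  refine hom_ext K fun v => ?_
  simp only [LinearMap.add_apply, LinearMap.comp_apply, consMap_gen, LinearMap.zero_apply]
  -- expand `e(ab, ab, v) = 0` in slot 0 and then in slot 1
  have h0 : gen K (Fin.cons (a * b) (Fin.cons (a * b) v) : Fin (n + 2) → K) = 0 :=
    gen_eq_zero_of_apply_eq K _ (i := 0) (j := 1) zero_ne_one (by simp)
  have h1 : gen K (Fin.cons (a * b) (Fin.cons (a * b) v) : Fin (n + 2) → K) =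
      gen K (Fin.cons a (Fin.cons (a * b) v)) + gen K (Fin.cons b (Fin.cons (a * b) v)) := by
    simpa only [Fin.update_cons_zero] using gen_update_mul K (Fin.cons (a * b) (Fin.cons (a * b) v)) 0 ha hb
  have h2 : ∀ c : K, gen K (Fin.cons c (Fin.cons (a * b) v) : Fin (n + 2) → K) =
      gen K (Fin.cons c (Fin.cons a v)) + gen K (Fin.cons c (Fin.cons b v)) := fun c => by
    simpa only [update_cons_cons_one] using gen_update_mul K (Fin.cons c (Fin.cons (a * b) v)) 1 ha hb
  have haa : gen K (Fin.cons a (Fin.cons a v) : Fin (n + 2) → K) = 0 :=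
    gen_eq_zero_of_apply_eq K _ (i := 0) (j := 1) zero_ne_one (by simp)
  have hbb : gen K (Fin.cons b (Fin.cons b v) : Fin (n + 2) → K) = 0 :=
    gen_eq_zero_of_apply_eq K _ (i := 0) (j := 1) zero_ne_one (by simp)
  rw [h1, h2 a, h2 b, haa, hbb, zero_add, add_zero] at h0
  exact h0

/-! ### The multilinear symbol map `(ω₁, …, ωₙ) ↦ Λₙ(ω₁, …, ωₙ)`, slot by slot -/

/-- The derivation `a ↦ a • e(a, –)` driving the inductive step: for a `K`-multilinear
`A : Ω[K⁄ℤ]ⁿ → BlochKatoForms K n`, the map `a ↦ a • (consMap a ∘ A)` is a `ℤ`-derivation of `K`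
with values in the `K`-module of multilinear maps `Ω[K⁄ℤ]ⁿ → BlochKatoForms K (n + 1)`
(additivity is relation (Q), the Leibniz rule is relation (M)). [cite: BlochKato1986, Lemma (4.2)] -/
def der (A : MultilinearMap K (fun _ : Fin n => Ω[K⁄ℤ]) (BlochKatoForms K n)) :
    Derivation ℤ K (MultilinearMap K (fun _ : Fin n => Ω[K⁄ℤ]) (BlochKatoForms K (n + 1))) :=
  Derivation.mk'
    (AddMonoidHom.toIntLinearMap
      { toFun := fun a => a • (consMap K n a).compMultilinearMap A
        map_zero' := by rw [zero_smul]
        map_add' := fun a b => by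
          ext m
          have h := congrArg (fun L : BlochKatoForms K n →ₗ[K] BlochKatoForms K (n + 1) => L (A m))
            (add_smul_consMap K n a b)
          simpa only [LinearMap.smul_apply, LinearMap.add_apply, smul_apply,
            LinearMap.compMultilinearMap_apply, add_apply] using h })
    (fun a b => by
      ext m
      simp only [AddMonoidHom.coe_toIntLinearMap, AddMonoidHom.coe_mk, ZeroHom.coe_mk,
        smul_apply, LinearMap.compMultilinearMap_apply, add_apply]
      by_cases ha : a = 0
      · simp [ha]
      by_cases hb : b = 0
      · simp [hb]
      simp only [consMap_mul K n ha hb, LinearMap.add_apply, smul_add, smul_smul, mul_comm b a]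
      abel)

/-- `der A a = a • (consMap a ∘ A)`. [folklore] -/
@[simp] theorem der_apply (A : MultilinearMap K (fun _ : Fin n => Ω[K⁄ℤ]) (BlochKatoForms K n)) (a : K) :
    der K n A a = a • (consMap K n a).compMultilinearMap A := rfl

variable {n} in
/-- **The multilinear symbol map** `Λₙ : Ω[K⁄ℤ]ⁿ → BlochKatoForms K n`,
`(da₁, …, daₙ) ↦ (∏ aᵢ) • e(a₁, …, aₙ)` (`alt_D`), defined by induction on `n`: `Λ₀ = e()`, and
`Λₙ₊₁(ω₀, ω) = L(ω₀)(ω)` where `L : Ω[K⁄ℤ] → (multilinear maps)` is the `K`-linear map induced by the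
derivation `der Λₙ` (`Derivation.liftKaehlerDifferential`, `LinearMap.uncurryLeft`).
[cite: BlochKato1986, Lemma (4.2)] -/
def alt : (n : ℕ) → MultilinearMap K (fun _ : Fin n => Ω[K⁄ℤ]) (BlochKatoForms K n)
  | 0 => MultilinearMap.constOfIsEmpty K _ (gen K fun i => i.elim0)
  | n + 1 => LinearMap.uncurryLeft (R := K) (M := fun _ : Fin (n + 1) => Ω[K⁄ℤ])
      (M₂ := BlochKatoForms K (n + 1)) (der K n (alt n)).liftKaehlerDifferential

/-- `Λ₀() = e()`. [folklore] -/
theorem alt_zero_apply (m : Fin 0 → Ω[K⁄ℤ]) : alt K 0 m = gen K fun i => i.elim0 := rfl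

/-- The inductive step unfolded: `Λₙ₊₁(m) = L(m 0)(tail m)`. [folklore] -/
theorem alt_succ_apply (m : Fin (n + 1) → Ω[K⁄ℤ]) :
    alt K (n + 1) m = (der K n (alt K n)).liftKaehlerDifferential (m 0) (Fin.tail m) := rfl

/-- `Λₙ₊₁(da, ω) = a • e(a, –) ∘ Λₙ(ω)`. [folklore] -/
theorem alt_cons_D (a : K) (m : Fin n → Ω[K⁄ℤ]) :
    alt K (n + 1) (Fin.cons (D ℤ K a) m) = a • consMap K n a (alt K n m) := by
  rw [alt_succ_apply, Fin.cons_zero, Fin.tail_cons, Derivation.liftKaehlerDifferential_comp_D, der_apply,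
    smul_apply, LinearMap.compMultilinearMap_apply]

variable {n} in
/-- **`Λₙ(da₁, …, daₙ) = (∏ aᵢ) • e(a₁, …, aₙ)`.** [cite: BlochKato1986, Lemma (4.2)] -/
theorem alt_D : ∀ {n : ℕ} (v : Fin n → K), alt K n (fun i => D ℤ K (v i)) = (∏ i, v i) • gen K v
  | 0, v => by
    rw [alt_zero_apply, Fin.prod_univ_zero, one_smul, Subsingleton.elim (fun i : Fin 0 => i.elim0) v]
  | n + 1, v => by
    conv_lhs => rw [← Fin.cons_self_tail (fun i => D ℤ K (v i))]
    rw [alt_cons_D]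
    change v 0 • consMap K n (v 0) (alt K n fun i => D ℤ K (Fin.tail v i)) = _
    rw [alt_D (Fin.tail v), map_smul, consMap_gen, Fin.cons_self_tail, smul_smul, Fin.prod_univ_succ]
    rfl

/-! ### `Λₙ` is alternating -/

/-- If `Λₙ(w) = 0` then `Λₙ₊₁(ω₀, w) = 0` for every `ω₀` (the slot-`0` map is linear in `ω₀` and
vanishes on the spanning set `{da}`). [folklore] -/
theorem alt_cons_eq_zero_of_eq_zero (w : Fin n → Ω[K⁄ℤ]) (hw : alt K n w = 0) (ω₀ : Ω[K⁄ℤ]) :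
    alt K (n + 1) (Fin.cons ω₀ w) = 0 := by
  rw [alt_succ_apply, Fin.cons_zero, Fin.tail_cons]
  have hmem : ω₀ ∈ Submodule.span K (Set.range (D ℤ K)) := by
    rw [KaehlerDifferential.span_range_derivation]; trivial
  induction hmem using Submodule.span_induction with
  | mem x hx =>
    obtain ⟨a, rfl⟩ := hx
    rw [Derivation.liftKaehlerDifferential_comp_D, der_apply, smul_apply,
      LinearMap.compMultilinearMap_apply, hw, map_zero, smul_zero]
  | zero => rw [map_zero, zero_apply]
  | add x y _ _ hx hy => rw [map_add, add_apply, hx, hy, add_zero]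
  | smul c x _ hx => rw [map_smul, smul_apply, hx, smul_zero]

/-- Vanishing of `Λₙ₊₁` when two TAIL slots agree, from the alternating property of `Λₙ`.
[folklore] -/
theorem alt_succ_eq_zero_of_tail
    (IH : ∀ (w' : Fin n → Ω[K⁄ℤ]) (i j : Fin n), i ≠ j → w' i = w' j → alt K n w' = 0)
    (w : Fin (n + 1) → Ω[K⁄ℤ]) (i j : Fin n) (hij : i ≠ j) (h : w i.succ = w j.succ) :
    alt K (n + 1) w = 0 := by
  rw [← Fin.cons_self_tail w]
  exact alt_cons_eq_zero_of_eq_zero K n (Fin.tail w) (IH (Fin.tail w) i j hij h) (w 0)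

/-- `Λₙ₊₂(da, db, t) = (a b) • e(a, –) ∘ e(b, –) ∘ Λₙ(t)`. [folklore] -/
theorem alt_cons_cons_D_D (a b : K) (t : Fin n → Ω[K⁄ℤ]) :
    alt K (n + 2) (Fin.cons (D ℤ K a) (Fin.cons (D ℤ K b) t)) =
      (a * b) • consMap K (n + 1) a (consMap K n b (alt K n t)) := by
  rw [alt_cons_D, alt_cons_D, map_smul, smul_smul]

/-- A multilinear map that vanishes whenever the slots `p ≠ q` agree is antisymmetric in `(p, q)`.
[folklore] -/
private theorem multilinear_swap_of_eq_zero {ι : Type*} [DecidableEq ι] {M N : Type*}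
    [AddCommGroup M] [Module K M] [AddCommGroup N] [Module K N]
    (f : MultilinearMap K (fun _ : ι => M) N) {p q : ι} (hpq : p ≠ q)
    (hf : ∀ u : ι → M, u p = u q → f u = 0) (w : ι → M) :
    f (w ∘ Equiv.swap p q) = -f w := by
  rw [Equiv.comp_swap_eq_update, eq_neg_iff_add_eq_zero]
  set s : M := w p + w q with hs
  have h0 : f (update (update w q s) p s) = 0 :=
    hf _ (by rw [Function.update_self, Function.update_of_ne hpq.symm, Function.update_self])
  have e2 : ∀ x : M, update (update w q s) p x = update (update w p x) q s := fun x =>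
    Function.update_comm hpq.symm s x w
  rw [hs, MultilinearMap.map_update_add, ← hs, e2, e2, MultilinearMap.map_update_add,
    MultilinearMap.map_update_add] at h0
  have h1 : f (update (update w p (w p)) q (w p)) = 0 :=
    hf _ (by rw [Function.update_self, Function.update_of_ne hpq, Function.update_self])
  have h2 : f (update (update w p (w q)) q (w q)) = 0 :=
    hf _ (by rw [Function.update_self, Function.update_of_ne hpq, Function.update_self])
  have e3 : update (update w p (w q)) q (w p) = update (update w q (w p)) p (w q) :=
    Function.update_comm hpq (w q) (w p) w
  rw [h1, zero_add, h2, add_zero, Function.update_eq_self, Function.update_eq_self, e3, add_comm] at h0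
  exact h0

/-- Vanishing of `Λₙ₊₂` when the slots `0` and `1` agree — the heart of the alternating property:
polarisation of the quadratic map `x ↦ Λₙ₊₂(x, x, t)` over the spanning set `{da}` using
`e(a, a, –) = 0` and `e(a, b, –) + e(b, a, –) = 0`. [cite: BlochKato1986, Lemma (4.2)] -/
theorem alt_eq_zero_of_apply_zero_eq_apply_one (w : Fin (n + 2) → Ω[K⁄ℤ]) (h : w 0 = w 1) :
    alt K (n + 2) w = 0 := by
  set t : Fin n → Ω[K⁄ℤ] := Fin.tail (Fin.tail w) with ht
  set f := alt K (n + 2) with hf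
  -- `β x y = Λ(x, y, t)` and its bilinearity
  let β : Ω[K⁄ℤ] → Ω[K⁄ℤ] → BlochKatoForms K (n + 2) := fun x y => f (Fin.cons x (Fin.cons y t))
  have hβ : ∀ x y, β x y = f (Fin.cons x (Fin.cons y t)) := fun x y => rfl
  have add₁ : ∀ x x' y, β (x + x') y = β x y + β x' y := fun x x' y => f.cons_add _ x x'
  have smul₁ : ∀ (c : K) x y, β (c • x) y = c • β x y := fun c x y => f.cons_smul _ c x
  have add₂ : ∀ x y y', β x (y + y') = β x y + β x y' := fun x y y' => by
    simp only [hβ, ← MultilinearMap.curryLeft_apply f x, MultilinearMap.cons_add]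
  have smul₂ : ∀ (c : K) x y, β x (c • y) = c • β x y := fun c x y => by
    simp only [hβ, ← MultilinearMap.curryLeft_apply f x, MultilinearMap.cons_smul]
  have zero₁ : ∀ y, β 0 y = 0 := fun y => by
    have := smul₁ 0 0 y; rwa [zero_smul, zero_smul] at this
  have zero₂ : ∀ x, β x 0 = 0 := fun x => by
    have := smul₂ 0 x 0; rwa [zero_smul, zero_smul] at this
  -- values on generators
  have hDD : ∀ a b : K, β (D ℤ K a) (D ℤ K b) =
      (a * b) • consMap K (n + 1) a (consMap K n b (alt K n t)) := fun a b => alt_cons_cons_D_D K n a b t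
  have hspan : ∀ x : Ω[K⁄ℤ], x ∈ Submodule.span K (Set.range (D ℤ K)) := fun x => by
    rw [KaehlerDifferential.span_range_derivation]; trivial
  -- the polar form vanishes
  have hB : ∀ x y, β x y + β y x = 0 := by
    have hBDD : ∀ a b : K, β (D ℤ K a) (D ℤ K b) + β (D ℤ K b) (D ℤ K a) = 0 := by
      intro a b
      rw [hDD, hDD, mul_comm b a, ← smul_add]
      by_cases ha : a = 0
      · rw [ha, zero_mul, zero_smul]
      by_cases hb : b = 0
      · rw [hb, mul_zero, zero_smul]
      have hc := congrArg (fun L : BlochKatoForms K n →ₗ[K] BlochKatoForms K (n + 2) => L (alt K n t))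
        (consMap_comp_consMap_add K n ha hb)
      simp only [LinearMap.add_apply, LinearMap.comp_apply, LinearMap.zero_apply] at hc
      rw [hc, smul_zero]
    have hBD : ∀ (a : K) (y : Ω[K⁄ℤ]), β (D ℤ K a) y + β y (D ℤ K a) = 0 := by
      intro a y
      induction hspan y using Submodule.span_induction with
      | mem y hy => obtain ⟨b, rfl⟩ := hy; exact hBDD a b
      | zero => rw [zero₁, zero₂, add_zero]
      | add y y' _ _ hy hy' => rw [add₂, add₁, add_add_add_comm, hy, hy', add_zero]
      | smul c y _ hy => rw [smul₂, smul₁, ← smul_add, hy, smul_zero]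
    intro x y
    induction hspan x using Submodule.span_induction with
    | mem x hx => obtain ⟨a, rfl⟩ := hx; exact hBD a y
    | zero => rw [zero₁, zero₂, add_zero]
    | add x x' _ _ hx hx' => rw [add₁, add₂, add_add_add_comm, hx, hx', add_zero]
    | smul c x _ hx => rw [smul₁, smul₂, ← smul_add, hx, smul_zero]
  -- the quadratic map vanishes
  have hQ : ∀ x, β x x = 0 := by
    intro x
    induction hspan x using Submodule.span_induction with
    | mem x hx =>
      obtain ⟨a, rfl⟩ := hx
      rw [hDD]
      have hc := congrArg (fun L : BlochKatoForms K n →ₗ[K] BlochKatoForms K (n + 2) => L (alt K n t))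
        (consMap_comp_consMap_self K n a)
      simp only [LinearMap.comp_apply, LinearMap.zero_apply] at hc
      rw [hc, smul_zero]
    | zero => exact zero₁ 0
    | add x x' _ _ hx hx' => rw [add₁, add₂, add₂, hx, hx', zero_add, add_zero, hB]
    | smul c x _ hx => rw [smul₁, smul₂, hx, smul_zero, smul_zero]
  -- conclude
  have hw : w = Fin.cons (w 0) (Fin.cons (w 1) t) := by
    conv_lhs => rw [← Fin.cons_self_tail w, ← Fin.cons_self_tail (Fin.tail w)]
    rfl
  rw [hw, ← hβ, h]
  exact hQ (w 1)

/-- **`Λₙ` is alternating**: `Λₙ(w) = 0` whenever two distinct slots of `w` agree.  Induction on `n`: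
both slots in the tail — the inductive hypothesis (`alt_succ_eq_zero_of_tail`); slots `0` and `1` —
`alt_eq_zero_of_apply_zero_eq_apply_one`; slots `0` and `j ≥ 2` — reduced to the previous case by
the antisymmetry in the tail slots `1` and `j`. [cite: BlochKato1986, Lemma (4.2)] -/
theorem alt_eq_zero_of_eq : ∀ (n : ℕ) (w : Fin n → Ω[K⁄ℤ]) (i j : Fin n), i ≠ j → w i = w j →
    alt K n w = 0
  | 0, _, i, _, _, _ => i.elim0
  | 1, _, i, j, hij, _ => absurd (Subsingleton.elim i j) hij
  | n + 2, w, i, j, hij, h => by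
    have Htail : ∀ (u : Fin (n + 2) → Ω[K⁄ℤ]) (i j : Fin (n + 1)), i ≠ j → u i.succ = u j.succ →
        alt K (n + 2) u = 0 :=
      fun u i j hij h => alt_succ_eq_zero_of_tail K (n + 1) (alt_eq_zero_of_eq (n + 1)) u i j hij h
    -- slots `0` and `j'.succ`
    have H0 : ∀ (u : Fin (n + 2) → Ω[K⁄ℤ]) (j' : Fin (n + 1)), u 0 = u j'.succ → alt K (n + 2) u = 0 := by
      intro u j' hu
      rcases Fin.eq_zero_or_eq_succ j' with rfl | ⟨j'', rfl⟩
      · exact alt_eq_zero_of_apply_zero_eq_apply_one K n u hu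
      · -- swap the tail slots `1 = (0 : Fin (n+1)).succ` and `j''.succ.succ`
        have hs := multilinear_swap_of_eq_zero K (alt K (n + 2))
          (p := (0 : Fin (n + 1)).succ) (q := j''.succ.succ)
          (fun e => Fin.succ_ne_zero j'' (Fin.succ_injective _ e).symm)
          (fun u' hu' => Htail u' 0 j''.succ (Fin.succ_ne_zero j'').symm hu') u
        have h01 : (u ∘ Equiv.swap (0 : Fin (n + 1)).succ j''.succ.succ) 0 =
            (u ∘ Equiv.swap (0 : Fin (n + 1)).succ j''.succ.succ) 1 := by
          simp only [Function.comp_apply]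
          rw [Equiv.swap_apply_of_ne_of_ne (Fin.succ_ne_zero _).symm (Fin.succ_ne_zero _).symm,
            show (1 : Fin (n + 2)) = (0 : Fin (n + 1)).succ from rfl, Equiv.swap_apply_left]
          exact hu
        have h0 := alt_eq_zero_of_apply_zero_eq_apply_one K n _ h01
        rwa [hs, neg_eq_zero] at h0
    rcases Fin.eq_zero_or_eq_succ i with rfl | ⟨i', rfl⟩ <;>
      rcases Fin.eq_zero_or_eq_succ j with rfl | ⟨j', rfl⟩
    · exact absurd rfl hij
    · exact H0 w j' h
    · exact H0 w i' h.symm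
    · exact Htail w i' j' (fun e => hij (congrArg Fin.succ e)) h

/-- `Λₙ` as an alternating map. [cite: BlochKato1986, Lemma (4.2)] -/
def altAlt : Ω[K⁄ℤ] [⋀^Fin n]→ₗ[K] BlochKatoForms K n :=
  { alt K n with map_eq_zero_of_eq' := fun w i j h hij => alt_eq_zero_of_eq K n w i j hij h }

/-- `altAlt` is `Λₙ` on tuples. [folklore] -/
@[simp] theorem altAlt_apply (w : Fin n → Ω[K⁄ℤ]) : altAlt K n w = alt K n w := rfl

/-! ### The comparison map on `n`-forms -/

/-- **The Bloch–Kato comparison map on `n`-forms** `Ωⁿ_K = ⋀ⁿ_K Ω[K⁄ℤ] → BlochKatoForms K n`,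
`b • (da₁ ∧ ⋯ ∧ daₙ) ↦ (b ∏ aᵢ) • e(a₁, …, aₙ)`, i.e. `x · dlog y₁ ∧ ⋯ ∧ dlog yₙ ↦ x • e(y)` — the
inverse of Bloch–Kato's `δ` (the universal property of the exterior power applied to the alternating
map `Λₙ`). [cite: BlochKato1986, Lemma (4.2), p. 122] -/
def ofForms : ⋀[K]^n (Ω[K⁄ℤ]) →ₗ[K] BlochKatoForms K n :=
  exteriorPower.alternatingMapLinearEquiv (altAlt K n)

/-- `ofForms (ω₁ ∧ ⋯ ∧ ωₙ) = Λₙ(ω₁, …, ωₙ)`. [folklore] -/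
@[simp] theorem ofForms_ιMulti (w : Fin n → Ω[K⁄ℤ]) :
    ofForms K n (exteriorPower.ιMulti K n w) = alt K n w :=
  exteriorPower.alternatingMapLinearEquiv_apply_ιMulti _ _

/-- `ofForms (da₁ ∧ ⋯ ∧ daₙ) = (∏ aᵢ) • e(a₁, …, aₙ)`. [cite: BlochKato1986, Lemma (4.2)] -/
theorem ofForms_ιMulti_D (v : Fin n → K) :
    ofForms K n (exteriorPower.ιMulti K n fun i => D ℤ K (v i)) = (∏ i, v i) • gen K v := by
  rw [ofForms_ιMulti, alt_D]

/-- `ofForms (dlog b₁ ∧ ⋯ ∧ dlog bₙ) = e(b₁, …, bₙ)`: the comparison map inverts Bloch–Kato's `δ` on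
the generators. [cite: BlochKato1986, Lemma (4.2)] -/
theorem ofForms_dlogForm (b : Fin n → Kˣ) : ofForms K n (dlogForm K b) = gen K fun i => (b i : K) := by
  have h : dlogForm K b = (∏ i, (((b i)⁻¹ : Kˣ) : K)) • exteriorPower.ιMulti K n fun i => D ℤ K (b i) := by
    rw [dlogForm, ← AlternatingMap.map_smul_univ]
    rfl
  rw [h, map_smul, ofForms_ιMulti_D, smul_smul, ← Finset.prod_mul_distrib]
  simp only [Units.inv_mul, Finset.prod_const_one, one_smul]

end BlochKatoForms

end Literature.NumberTheory.GaloisCohomology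

end
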